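import Mathlib
import Summits.ResolutionOfSingularities.ResolutionOfSingularities.Theorems.WeightedInvariantLocalWeightedDropNCResSurfGraphChart

/-!
# `WeightedInvariant.LocalWeightedDrop`: NC-resolution settings for the TOT₂ line — GRAPH SURFACES, part 11: the CHART IDENTITY OF THE CURVE MOVE
# along `Γ_a = S ∩ E_a` at its near point (the strict transform of the surface is again a graph surface, over the exceptional letter and the
# parameter letter of the curve) and the PERMISSIBILITY of the new base plane

Crux item stmt-ResolutionOfSingularities-8899 `LocalWeightedDrop` (route `ResolutionOfSingularities/WeightedInvariant`), ENGINE skeleton v32/v33, residuals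
`stub_spaceNCRankDrop` / `stub_wildWideApexFourStartsWon` (res-L1-w43-strat-1's line `directrix-cut` v3.1, piece PL = `ApexPlaneExit`, SURFACE sub-case;
design memo `L/res-L1-w43-stub-4/g5/S-E2-SURF.md` §6).  [OURS · L1 W4.3 · chain w43 · seat res-L1-w43-stub-4 gen 5; two bookkeeping definitions
(`curveStepSeries`, `curveStep`) + the identity; the curve-move twin of part 6 (`…NCResSurfGraphChart`); the count game is the programme's own; nothing
here is a statement of any manuscript; AI-produced, gate-checked, weaker than expert review.]

SETTING (memo §6).  Graph surface `(a, b, ψ)`; a letter set `E` whose off-base members have traces divisible by `u₁` (`Γ_a ⊂ E_l`); the move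
`(Φ̂, w)` with `Φ̂ = shear_{a,b}(ψ̂)` (`ψ̂ = 0` on `E`, `ψ` elsewhere) and `w = 𝟙_{≠ b}` (centre `Γ_a`, parameter letter `b`); its near point read at the
slot `a`: `c_a ≠ 0`, `c_b = 0`, `c_l = c_a ∂₁ψ_l(0)` (`l ∈ E` off-base), `c_j = 0` (`j ∉ E` off-base).  The weighted restricted chart is
`x_a ↦ c_a s`, `x_b ↦ u` (`u = y_{b′}`, `b′ = predAbove a (succ b)`), `x_l ↦ s (c_l + y_{l′})` otherwise.  The strict transform of the surface is the
graph over the new base `(b′, 0)` with datum `curveStep`: `y_{l′} = ψ_l(c_a s, u)/s − c_l` on `E`, `0` off `E`.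
* `curveStepSeries ψ λ a := ψ(λ s, u)/s − a` (for `u₁ ∣ ψ`), `X_one_mul_curveStepSeries`, `constantCoeff_curveStepSeries`;
* `curveStep a b ψ E c` — the successor datum; `constantCoeff_curveStep_of_ne`, `hasSubst_shear_curveStep`;
* `hasSubst_wchart` — the weighted restricted chart family may be substituted (`c_b = 0`);
* **`subst_curveChart_shear`** — (C2′): `ρ^w_{c_a e_a} ∘ shear_{a,b}(ψ) = shear_{b′,0}(curveStep) ∘ ρ^w_c ∘ Φ̂` on every germ;
* **`inOffPlaneIdeal_curveChart_step`** — (C3′): permissibility of `(a,b,ψ)` at order `c` for `F` ⇒ permissibility of `(b′, 0, curveStep)` at order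
  `c` for `ρ^{w*}_c (Φ̂^* F)`.
-/

set_option linter.dupNamespace false -- mandated namespace of this single-conjunct summit

noncomputable section

namespace Summit.ResolutionOfSingularities.ResolutionOfSingularities.Theorems

namespace TameFourTupleDrop

namespace GraphSurf

open MvPowerSeries Literature.AlgebraicGeometry.Resolution

variable {k : Type} [Field k] {m : ℕ}

/-! ## The curve-step series -/

/-- The substitution family `u₁ ↦ λ s`, `u₂ ↦ u` (`u = X 0`, `s = X 1`) may be substituted. -/
theorem hasSubst_curveBase (lam : k) : HasSubst (![C lam * X 1, X 0] : Fin 2 → MvPowerSeries (Fin 2) k) :=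
  hasSubst_of_constantCoeff_zero fun t => by fin_cases t <;> simp [constantCoeff_X]

/-- `s ∣ ψ(λ s, u)` when `u₁ ∣ ψ`. -/
theorem X_one_dvd_subst_curveBase (lam : k) {ψ : MvPowerSeries (Fin 2) k} (h : (X 0 : MvPowerSeries (Fin 2) k) ∣ ψ) :
    (X 1 : MvPowerSeries (Fin 2) k) ∣ subst ![C lam * X 1, X 0] ψ := by
  obtain ⟨q, rfl⟩ := h
  refine ⟨C lam * subst ![C lam * X 1, X 0] q, ?_⟩
  rw [subst_mul (hasSubst_curveBase lam), subst_X (hasSubst_curveBase lam)]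
  simp only [Matrix.cons_val_zero]
  ring

/-- THE CURVE-STEP SERIES `ψ(λ s, u)/s − a`: the graph component, over the new base `(u, s)`, of the strict transform of the surface under the curve
move along `Γ_a` at its near point (`λ = c_a`, `a = c_l = λ ∂₁ψ_l(0)`). [OURS] -/
def curveStepSeries (ψ : MvPowerSeries (Fin 2) k) (lam a : k) : MvPowerSeries (Fin 2) k :=
  divX₁ (subst ![C lam * X 1, X 0] ψ) - C a

/-- `s · curveStepSeries = ψ(λ s, u) − a s` when `u₁ ∣ ψ`. -/
theorem X_one_mul_curveStepSeries {ψ : MvPowerSeries (Fin 2) k} (h : (X 0 : MvPowerSeries (Fin 2) k) ∣ ψ) (lam a : k) :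
    X 1 * curveStepSeries ψ lam a = subst ![C lam * X 1, X 0] ψ - C a * X 1 := by
  rw [curveStepSeries, mul_sub, X_one_mul_divX₁ (X_one_dvd_subst_curveBase lam h)]
  ring

/-- The curve-step series has zero constant term when `a = λ ∂₁ψ(0)` (the near point). -/
theorem constantCoeff_curveStepSeries {ψ : MvPowerSeries (Fin 2) k} {lam a : k}
    (ha : a = lam * coeff (Finsupp.single 0 1) ψ) : constantCoeff (curveStepSeries ψ lam a) = 0 := by
  classical
  have hσ0 : ∀ t, constantCoeff ((![C lam * X 1, X 0] : Fin 2 → MvPowerSeries (Fin 2) k) t) = 0 := fun t => by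
    fin_cases t <;> simp [constantCoeff_X]
  have h1a : coeff (Finsupp.single 1 1) (C lam * X 1 : MvPowerSeries (Fin 2) k) = lam := by
    rw [coeff_C_mul, coeff_X, if_pos rfl, mul_one]
  have h1b : coeff (Finsupp.single 1 1) (X 0 : MvPowerSeries (Fin 2) k) = 0 := by
    rw [coeff_X, if_neg]
    intro h
    have h0 := Finsupp.ext_iff.mp h 0
    simp at h0
  rw [curveStepSeries, map_sub, constantCoeff_C, ← coeff_zero_eq_constantCoeff_apply, coeff_divX₁, zero_add,
    NCTransport.coeff_single_subst_eq_sum_of_constantCoeff_zero hσ0 ψ 1, Fin.sum_univ_two]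
  simp only [Matrix.cons_val_zero, Matrix.cons_val_one]
  rw [h1a, h1b, ha, mul_zero, add_zero, mul_comm, sub_self]

/-! ## The successor datum -/

/-- THE SUCCESSOR GRAPH DATUM OF THE CURVE MOVE along `Γ_a`, indexed by the successor's letters: `0 ↦ 0`, and for `p.succ` (old letter
`j = a.succAbove p`): `curveStepSeries (ψ_j) c_a c_j` if `j ∈ E`, `0` if `j ∉ E` (the partial shear had already straightened those). [OURS] -/
def curveStep (a : Fin (m + 1)) (ψ : Fin (m + 1) → MvPowerSeries (Fin 2) k) (E : Finset (Fin (m + 1))) (c : Fin (m + 1) → k) :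
    Fin (m + 1) → MvPowerSeries (Fin 2) k :=
  fun j' => Fin.cases (motive := fun _ => MvPowerSeries (Fin 2) k) 0
    (fun p => if a.succAbove p ∈ E then curveStepSeries (ψ (a.succAbove p)) (c a) (c (a.succAbove p)) else 0) j'

/-- Values of the successor datum. -/
theorem curveStep_succ (a : Fin (m + 1)) (ψ : Fin (m + 1) → MvPowerSeries (Fin 2) k) (E : Finset (Fin (m + 1))) (c : Fin (m + 1) → k)
    (p : Fin m) : curveStep a ψ E c p.succ =
      if a.succAbove p ∈ E then curveStepSeries (ψ (a.succAbove p)) (c a) (c (a.succAbove p)) else 0 := by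
  simp [curveStep]

/-- The successor datum has zero constant terms off the new base (at the near point). -/
theorem constantCoeff_curveStep_of_ne {a b : Fin (m + 1)} {ψ : Fin (m + 1) → MvPowerSeries (Fin 2) k}
    {E : Finset (Fin (m + 1))} {c : Fin (m + 1) → k}
    (hcE : ∀ l ∈ E, ¬ (l = a ∨ l = b) → c l = c a * coeff (Finsupp.single 0 1) (ψ l))
    (j' : Fin (m + 1)) (hj' : ¬ (j' = Fin.predAbove a b.succ ∨ j' = 0)) : constantCoeff (curveStep a ψ E c j') = 0 := by
  obtain ⟨p, rfl⟩ : ∃ p : Fin m, p.succ = j' := Fin.exists_succ_eq.mpr (fun h => hj' (Or.inr h))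
  rw [curveStep_succ]
  have hjab : ¬ (a.succAbove p = a ∨ a.succAbove p = b) := by
    rintro (h | h)
    · exact Fin.succAbove_ne a p h
    · exact hj' (Or.inl (by rw [← h, RestrictedChartTransport.predAbove_succAbove_succ]))
  split_ifs with hE
  · exact constantCoeff_curveStepSeries (hcE _ hE hjab)
  · exact map_zero _

/-- The successor shear may be substituted. -/
theorem hasSubst_shear_curveStep {a b : Fin (m + 1)} {ψ : Fin (m + 1) → MvPowerSeries (Fin 2) k}
    {E : Finset (Fin (m + 1))} {c : Fin (m + 1) → k}
    (hcE : ∀ l ∈ E, ¬ (l = a ∨ l = b) → c l = c a * coeff (Finsupp.single 0 1) (ψ l)) :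
    HasSubst (shear (Fin.predAbove a b.succ) 0 (curveStep a ψ E c)) :=
  hasSubst_shear (constantCoeff_curveStep_of_ne hcE)

/-! ## The weighted restricted chart and the chart identity -/

/-- The weighted restricted chart family of the curve move (`w = 𝟙_{≠ b}`, slot `a`), in simplified form: `x_b ↦ y_{b′}`, `x_a ↦ c_a s`,
`x_l ↦ s (c_l + y_{l′})` otherwise; it may be substituted. -/
theorem hasSubst_cchart (a b : Fin (m + 1)) (c : Fin (m + 1) → k) :
    HasSubst (fun l : Fin (m + 1) => if l = b then (X (Fin.predAbove a b.succ) : MvPowerSeries (Fin (m + 1)) k) else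
      X 0 * (C (c l) + if l = a then (0 : MvPowerSeries (Fin (m + 1)) k) else X (Fin.predAbove a l.succ))) := by
  refine hasSubst_of_constantCoeff_zero fun l => ?_
  by_cases hlb : l = b
  · simp [hlb, constantCoeff_X]
  · simp [hlb, constantCoeff_X]

/-- S-SET's weighted restricted chart family `x_l ↦ s^{w_l} (c_l + y_{l′})` for `w = 𝟙_{≠ b}` and `c_b = 0` IS the simplified family. -/
theorem wchart_eq_cchart {a b : Fin (m + 1)} (hab : a ≠ b) (c : Fin (m + 1) → k) (hcb : c b = 0) :
    (fun l : Fin (m + 1) => X 0 ^ ((fun j : Fin (m + 1) => if j = b then 0 else 1) l) * (C (c l) +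
      if l = a then (0 : MvPowerSeries (Fin (m + 1)) k) else X (Fin.predAbove a l.succ))) =
    (fun l : Fin (m + 1) => if l = b then (X (Fin.predAbove a b.succ) : MvPowerSeries (Fin (m + 1)) k) else
      X 0 * (C (c l) + if l = a then (0 : MvPowerSeries (Fin (m + 1)) k) else X (Fin.predAbove a l.succ))) := by
  have hba : b ≠ a := fun h => hab h.symm
  funext l
  by_cases hlb : l = b
  · subst hlb
    simp [hba, hcb]
  · simp [hlb]

/-- The successor shear fixes the exceptional letter and the transported parameter letter (both are base letters). -/
theorem subst_shear_curveStep_base {a b : Fin (m + 1)} {ψ : Fin (m + 1) → MvPowerSeries (Fin 2) k}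
    {E : Finset (Fin (m + 1))} {c : Fin (m + 1) → k}
    (hcE : ∀ l ∈ E, ¬ (l = a ∨ l = b) → c l = c a * coeff (Finsupp.single 0 1) (ψ l)) (φ : MvPowerSeries (Fin 2) k) :
    subst (shear (Fin.predAbove a b.succ) 0 (curveStep a ψ E c)) (subst ![X (Fin.predAbove a b.succ), (X 0 : MvPowerSeries (Fin (m + 1)) k)] φ) =
      subst ![X (Fin.predAbove a b.succ), (X 0 : MvPowerSeries (Fin (m + 1)) k)] φ := by
  have hS := hasSubst_shear_curveStep hcE
  have hB : HasSubst (![X (Fin.predAbove a b.succ), (X 0 : MvPowerSeries (Fin (m + 1)) k)] : Fin 2 → MvPowerSeries (Fin (m + 1)) k) :=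
    hasSubst_base _ _
  rw [subst_comp_subst_apply hB hS]
  congr 1
  funext t
  fin_cases t
  · simp [subst_X hS, shear_of_base]
  · simp [subst_X hS, shear_of_base]

/-- **(C2′) THE CHART IDENTITY OF THE CURVE MOVE.**  With the hypotheses of the setting (traces on `E` divisible by `u₁`; `c_l = c_a ∂₁ψ_l(0)` on
`E` and `c_j = 0` off `E`, off-base): `ρ_{c_a e_a} ∘ shear_{a,b}(ψ) = shear_{b′,0}(curveStep) ∘ ρ_c ∘ shear_{a,b}(ψ̂)` on every germ, for the
simplified chart family `ρ` of `hasSubst_cchart`. -/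
theorem subst_curveChart_shear {a b : Fin (m + 1)} (hab : a ≠ b) (ψ : Fin (m + 1) → MvPowerSeries (Fin 2) k)
    (hψ : ∀ j, ¬ (j = a ∨ j = b) → constantCoeff (ψ j) = 0) (E : Finset (Fin (m + 1)))
    (hE : ∀ l ∈ E, ¬ (l = a ∨ l = b) → (X 0 : MvPowerSeries (Fin 2) k) ∣ ψ l) (c : Fin (m + 1) → k)
    (hcE : ∀ l ∈ E, ¬ (l = a ∨ l = b) → c l = c a * coeff (Finsupp.single 0 1) (ψ l))
    (hcj : ∀ j, j ∉ E → ¬ (j = a ∨ j = b) → c j = 0) (F : MvPowerSeries (Fin (m + 1)) k) :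
    subst (fun l : Fin (m + 1) => if l = b then (X (Fin.predAbove a b.succ) : MvPowerSeries (Fin (m + 1)) k) else
        X 0 * (C (if l = a then c a else 0) + if l = a then (0 : MvPowerSeries (Fin (m + 1)) k) else X (Fin.predAbove a l.succ)))
        (subst (shear a b ψ) F) =
      subst (shear (Fin.predAbove a b.succ) 0 (curveStep a ψ E c))
        (subst (fun l : Fin (m + 1) => if l = b then (X (Fin.predAbove a b.succ) : MvPowerSeries (Fin (m + 1)) k) else
          X 0 * (C (c l) + if l = a then (0 : MvPowerSeries (Fin (m + 1)) k) else X (Fin.predAbove a l.succ)))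
          (subst (shear a b (fun j => if j ∈ E then 0 else ψ j)) F)) := by
  classical
  have hba : b ≠ a := fun h => hab h.symm
  have hρ0 := hasSubst_cchart a b (fun l => if l = a then c a else (0 : k))
  have hρ := hasSubst_cchart a b c
  have hψ' : ∀ j, ¬ (j = a ∨ j = b) → constantCoeff ((fun j => if j ∈ E then 0 else ψ j) j) = 0 := by
    intro j hj
    simp only
    split_ifs
    · exact map_zero _
    · exact hψ j hj
  have hS : HasSubst (shear (Fin.predAbove a b.succ) 0 (curveStep a ψ E c)) := hasSubst_shear_curveStep (b := b) hcE
  obtain ⟨q, hq⟩ := Fin.exists_succAbove_eq hba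
  have hpb : Fin.predAbove a b.succ = q.succ := by rw [← hq, RestrictedChartTransport.predAbove_succAbove_succ]
  -- the composite family `ρ_c ∘ shear(ψ̂)` may be substituted
  have hT : HasSubst (fun j => subst (fun l : Fin (m + 1) => if l = b then (X (Fin.predAbove a b.succ) : MvPowerSeries (Fin (m + 1)) k) else
      X 0 * (C (c l) + if l = a then (0 : MvPowerSeries (Fin (m + 1)) k) else X (Fin.predAbove a l.succ)))
      (shear a b (fun j => if j ∈ E then 0 else ψ j) j)) := by
    refine hasSubst_of_constantCoeff_zero fun j => ?_
    rw [TOT2E1.constantCoeff_subst_of_constantCoeff_zero _ (fun l => ?_) _]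
    · exact constantCoeff_shear hψ' j
    · by_cases hlb : l = b
      · simp [hlb, constantCoeff_X]
      · simp [hlb, constantCoeff_X]
  rw [subst_comp_subst_apply (hasSubst_shear hψ) hρ0, subst_comp_subst_apply (hasSubst_shear hψ') hρ, subst_comp_subst_apply hT hS]
  congr 1
  funext j
  -- the two base components of both charts agree: `x_a ↦ c_a s`, `x_b ↦ y_{b′}`
  have hbase : (![(fun l : Fin (m + 1) => if l = b then (X (Fin.predAbove a b.succ) : MvPowerSeries (Fin (m + 1)) k) else
      X 0 * (C (if l = a then c a else 0) + if l = a then (0 : MvPowerSeries (Fin (m + 1)) k) else X (Fin.predAbove a l.succ))) a,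
      (fun l : Fin (m + 1) => if l = b then (X (Fin.predAbove a b.succ) : MvPowerSeries (Fin (m + 1)) k) else
      X 0 * (C (if l = a then c a else 0) + if l = a then (0 : MvPowerSeries (Fin (m + 1)) k) else X (Fin.predAbove a l.succ))) b] :
        Fin 2 → MvPowerSeries (Fin (m + 1)) k) =
      fun t => subst ![X (Fin.predAbove a b.succ), (X 0 : MvPowerSeries (Fin (m + 1)) k)] ((![C (c a) * X 1, X 0] : Fin 2 → MvPowerSeries (Fin 2) k) t) := by
    have hB : HasSubst (![X (Fin.predAbove a b.succ), (X 0 : MvPowerSeries (Fin (m + 1)) k)] : Fin 2 → MvPowerSeries (Fin (m + 1)) k) :=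
      hasSubst_base _ _
    funext t
    fin_cases t
    · simp [hab, subst_mul hB, subst_X hB, subst_C, mul_comm]
    · simp [subst_X hB]
  have hbase' : (![(fun l : Fin (m + 1) => if l = b then (X (Fin.predAbove a b.succ) : MvPowerSeries (Fin (m + 1)) k) else
      X 0 * (C (c l) + if l = a then (0 : MvPowerSeries (Fin (m + 1)) k) else X (Fin.predAbove a l.succ))) a,
      (fun l : Fin (m + 1) => if l = b then (X (Fin.predAbove a b.succ) : MvPowerSeries (Fin (m + 1)) k) else
      X 0 * (C (c l) + if l = a then (0 : MvPowerSeries (Fin (m + 1)) k) else X (Fin.predAbove a l.succ))) b] :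
        Fin 2 → MvPowerSeries (Fin (m + 1)) k) =
      fun t => subst ![X (Fin.predAbove a b.succ), (X 0 : MvPowerSeries (Fin (m + 1)) k)] ((![C (c a) * X 1, X 0] : Fin 2 → MvPowerSeries (Fin 2) k) t) := by
    have hB : HasSubst (![X (Fin.predAbove a b.succ), (X 0 : MvPowerSeries (Fin (m + 1)) k)] : Fin 2 → MvPowerSeries (Fin (m + 1)) k) :=
      hasSubst_base _ _
    funext t
    fin_cases t
    · simp [hab, subst_mul hB, subst_X hB, subst_C, mul_comm]
    · simp [subst_X hB]
  have hB : HasSubst (![X (Fin.predAbove a b.succ), (X 0 : MvPowerSeries (Fin (m + 1)) k)] : Fin 2 → MvPowerSeries (Fin (m + 1)) k) :=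
    hasSubst_base _ _
  rcases Fin.eq_self_or_eq_succAbove a j with rfl | ⟨p, rfl⟩
  · -- `x_a ↦ c_a s` on both sides
    rw [shear_left, shear_left, subst_X hρ0, subst_X hρ]
    simp only [if_neg hab, if_true, add_zero]
    rw [subst_mul hS, subst_C, subst_X hS, shear_of_base (Or.inr rfl)]
  · have hj : a.succAbove p ≠ a := Fin.succAbove_ne a p
    by_cases hjb : a.succAbove p = b
    · -- `x_b ↦ y_{b′}` on both sides
      rw [hjb, shear_right, shear_right, subst_X hρ0, subst_X hρ]
      simp only [if_true]
      rw [subst_X hS, shear_of_base (Or.inl rfl)]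
    · have hjab : ¬ (a.succAbove p = a ∨ a.succAbove p = b) := not_or.mpr ⟨hj, hjb⟩
      have hp0 : ¬ ((p.succ : Fin (m + 1)) = Fin.predAbove a b.succ ∨ (p.succ : Fin (m + 1)) = 0) := by
        rintro (h | h)
        · rw [hpb] at h
          exact hjb (by rw [Fin.succ_inj.mp h, hq])
        · exact Fin.succ_ne_zero p h
      -- the left-hand side: `s · y_{j′} + ψ_j(c_a s, y_{b′})`
      rw [shear_of_ne hjab, subst_add hρ0, subst_X hρ0, subst_onPlane _ hρ0, hbase,
        ← subst_comp_subst_apply (hasSubst_curveBase (c a)) hB]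
      simp only [if_neg hjb, if_neg hj, RestrictedChartTransport.predAbove_succAbove_succ, map_zero, zero_add]
      by_cases hjE : a.succAbove p ∈ E
      · -- a boundary letter containing `Γ_a`: `Φ̂_j = x_j`, new component `curveStepSeries`
        rw [shear_eq_X_of_eq_zero (Or.inr (by simp [hjE])), subst_X hρ]
        simp only [if_neg hjb, if_neg hj, RestrictedChartTransport.predAbove_succAbove_succ]
        rw [subst_mul hS, subst_X hS, shear_of_base (Or.inr rfl), subst_add hS, subst_C, subst_X hS, shear_of_ne hp0, curveStep_succ,
          if_pos hjE, onPlane]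
        have key := X_one_mul_curveStepSeries (hE _ hjE hjab) (c a) (c (a.succAbove p))
        have key' : subst ![C (c a) * X 1, X 0] (ψ (a.succAbove p)) =
            X 1 * curveStepSeries (ψ (a.succAbove p)) (c a) (c (a.succAbove p)) + C (c (a.succAbove p)) * X 1 := by
          rw [key]; ring
        have h1 : subst (![X (Fin.predAbove a b.succ), (X 0 : MvPowerSeries (Fin (m + 1)) k)] : Fin 2 → MvPowerSeries (Fin (m + 1)) k)
            (X 1 : MvPowerSeries (Fin 2) k) = X 0 := by
          rw [subst_X hB]; rfl
        rw [key', subst_add hB, subst_mul hB, subst_mul hB, subst_C, h1]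
        ring
      · -- a letter off `E`: `Φ̂_j = x_j + ψ_j(x_a, x_b)`, new component `0`
        rw [shear_of_ne hjab, subst_add hρ, subst_X hρ, subst_onPlane _ hρ, hbase', ← subst_comp_subst_apply (hasSubst_curveBase (c a)) hB]
        simp only [if_neg hjb, if_neg hj, if_neg hjE, RestrictedChartTransport.predAbove_succAbove_succ, hcj _ hjE hjab, map_zero, zero_add]
        rw [subst_add hS, subst_mul hS, subst_X hS, shear_of_base (Or.inr rfl), subst_X hS, shear_of_ne hp0, curveStep_succ, if_neg hjE,
          onPlane_eq_substAlgHom, map_zero, add_zero, subst_shear_curveStep_base hcE]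


/-- **(C3′) THE NEW BASE PLANE IS PERMISSIBLE** (curve move).  If `(a, b, ψ)` is permissible at order `o` for `F`, then — under the hypotheses of
the setting — `(b′, 0, curveStep)` is permissible at order `o` for `ρ_c^* (Φ̂^* F)`: (C2′) and part 2's transport along `ρ_{c_a e_a}`. -/
theorem inOffPlaneIdeal_curveChart_step {a b : Fin (m + 1)} (hab : a ≠ b) {ψ : Fin (m + 1) → MvPowerSeries (Fin 2) k}
    (hψ : ∀ j, ¬ (j = a ∨ j = b) → constantCoeff (ψ j) = 0) {E : Finset (Fin (m + 1))}
    (hE : ∀ l ∈ E, ¬ (l = a ∨ l = b) → (X 0 : MvPowerSeries (Fin 2) k) ∣ ψ l) {c : Fin (m + 1) → k}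
    (hcE : ∀ l ∈ E, ¬ (l = a ∨ l = b) → c l = c a * coeff (Finsupp.single 0 1) (ψ l))
    (hcj : ∀ j, j ∉ E → ¬ (j = a ∨ j = b) → c j = 0) {o : ℕ} {F : MvPowerSeries (Fin (m + 1)) k}
    (hperm : InOffPlaneIdeal a b o (subst (shear a b ψ) F)) :
    InOffPlaneIdeal (Fin.predAbove a b.succ) 0 o (subst (shear (Fin.predAbove a b.succ) 0 (curveStep a ψ E c))
      (subst (fun l : Fin (m + 1) => if l = b then (X (Fin.predAbove a b.succ) : MvPowerSeries (Fin (m + 1)) k) else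
        X 0 * (C (c l) + if l = a then (0 : MvPowerSeries (Fin (m + 1)) k) else X (Fin.predAbove a l.succ)))
        (subst (shear a b (fun j => if j ∈ E then 0 else ψ j)) F))) := by
  have hba : b ≠ a := fun h => hab h.symm
  rw [← subst_curveChart_shear hab ψ hψ E hE c hcE hcj F]
  refine hperm.subst _ (hasSubst_cchart a b _) fun j hj => ?_
  have hja : j ≠ a := fun h => hj (Or.inl h)
  have hjb : j ≠ b := fun h => hj (Or.inr h)
  obtain ⟨p, rfl⟩ := Fin.exists_succAbove_eq hja
  obtain ⟨q, hq⟩ := Fin.exists_succAbove_eq hba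
  simp only [if_neg hja, if_neg hjb, map_zero, zero_add, RestrictedChartTransport.predAbove_succAbove_succ]
  refine (inOffPlaneIdeal_X_of_ne ?_).mul_left (X 0)
  rintro (h | h)
  · rw [← hq, RestrictedChartTransport.predAbove_succAbove_succ] at h
    exact hjb (by rw [Fin.succ_inj.mp h, hq])
  · exact Fin.succ_ne_zero p h

end GraphSurf

end TameFourTupleDrop

end Summit.ResolutionOfSingularities.ResolutionOfSingularities.Theorems

end
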